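import Literature.InformationTheory.QuantumCodes.CSSEquivalenceNoise
import Literature.InformationTheory.QuantumCodes.CSSMixedChannelThreshold
import HarnessLib

/-!
# Permutation-equivalent CSS codes have the same loss–error failure probabilities (erasure-aware decoders transported)

Topic `Literature/InformationTheory/QuantumCodes` (venture QEC, LADDER-QEC rung Q5; qec-type-03). All PROVED, no named fact,
kernel axioms. Companion of `CSSEquivalenceNoise.lean` (which transports the pure-erasure probability `uncorrectableProb` and
the pure-error failure sums along `CSSCode.reindex eX eZ eQ`) for the MIXED channel of Dumer–Kovalev–Pryadko / Stace–Barrett–Doherty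
(heralded erasures of rate `y` AND independent errors of rate `p`, erasure-aware decoders, `mixedFailureProb`,
`CSSMixedChannelThreshold.lean`):

* `reindexErasureDecoder eX eQ D` — the erasure-aware decoder of the re-indexed code conjugate to `D` (relabel the erasure
  pattern and the syndrome back, decode, relabel the correction); `reindexErasureDecoder_reindexErasureDecoder_symm` — every
  decoder of the re-indexed code is of this form;
* `erasureCorrects_reindex_iff` — conjugate decoders correct corresponding (erasure, error) pairs;
* `isMinWeightOutside_reindexErasureDecoder` — minimum weight outside the erasures is preserved;
* **`mixedFailureProb_reindex`** — `mixedFailureProb` of the `Z` sector is invariant: the loss–error phase diagram of a CSS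
  code is a permutation invariant (used to move the toric phase boundary to the census object `HGP(circ, circ)`).

## References

* [LinPryadko2024] H.-K. Lin, L. P. Pryadko, *Quantum two-block group algebra codes*, PRA 109 (2024) 022407 =
  arXiv:2306.16400, §4.2 Thm 6 (permutation-equivalent codes have the same parameters; App. proof of (i)).
* [DumerKovalevPryadko2015] I. Dumer, A. A. Kovalev, L. P. Pryadko, PRL 115 (2015) 050502, Thm 2 (the mixed channel).
* [DennisEtAl2002] Dennis–Kitaev–Landahl–Preskill, J. Math. Phys. 43 (2002) 4452, §4.4 eq. (prob_E).
-/

namespace Literature.InformationTheory.QuantumCodes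

open Finset Matrix

namespace CSSCode

variable {RX RZ Q RX' RZ' Q' : Type*} [Fintype Q] [Fintype Q'] [DecidableEq Q] [DecidableEq Q']

/-! ### Transported erasure-aware decoders -/

/-- **The erasure-aware decoder of the re-indexed code conjugate to `D`**: pull the erasure pattern back along `eQ`, the
syndrome back along `eX`, decode with `D`, push the correction forward.
[cite: LinPryadko2024, §4.2 Thm 6 and App. proof of (i) (arXiv:2306.16400 chunk p0018 L6–14)] -/
def reindexErasureDecoder (eX : RX ≃ RX') (eQ : Q ≃ Q') (D : ErasureDecoder Q (RX → ZMod 2)) :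
    ErasureDecoder Q' (RX' → ZMod 2) :=
  fun Er' s' => D (Er'.map eQ.symm.toEmbedding) (s' ∘ eX) ∘ eQ.symm

omit [Fintype Q] [Fintype Q'] [DecidableEq Q] [DecidableEq Q'] in
/-- **Every decoder of the re-indexed code is a transported one** (round trip along the inverse equivalences).
[cite: LinPryadko2024, §4.2 Thm 6 (arXiv:2306.16400 chunk p0009 L66–74)] -/
theorem reindexErasureDecoder_reindexErasureDecoder_symm (eX : RX ≃ RX') (eQ : Q ≃ Q')
    (D' : ErasureDecoder Q' (RX' → ZMod 2)) :
    reindexErasureDecoder eX eQ (reindexErasureDecoder eX.symm eQ.symm D') = D' := by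
  funext Er' s'
  have h1 : (Er'.map eQ.symm.toEmbedding).map eQ.symm.symm.toEmbedding = Er' := by
    rw [Equiv.symm_symm]; exact map_symm_map eQ Er'
  have h2 : (s' ∘ ⇑eX) ∘ ⇑eX.symm = s' := by funext r; simp
  simp only [reindexErasureDecoder, h1, h2]
  funext q
  simp

omit [DecidableEq Q] [DecidableEq Q'] in
/-- The re-indexed check matrix on a pushed-forward vector: `(H'^X (f ∘ eQ⁻¹)) ∘ eX = H^X f`.
[cite: LinPryadko2024, App. proof of Thm 6(i) (arXiv:2306.16400 chunk p0018 L6–14)] -/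
theorem reindex_HX_mulVec_comp_symm (C : CSSCode RX RZ Q) (eX : RX ≃ RX') (eZ : RZ ≃ RZ') (eQ : Q ≃ Q')
    (f : Q → ZMod 2) : ((C.reindex eX eZ eQ).HX *ᵥ (f ∘ eQ.symm)) ∘ eX = C.HX *ᵥ f := by
  have h := reindex_zSyndrome_comp C eX eZ eQ (f ∘ eQ.symm)
  have hf : (f ∘ ⇑eQ.symm) ∘ ⇑eQ = f := by funext q; simp
  rw [hf] at h
  exact h

omit [DecidableEq Q] [DecidableEq Q'] in
/-- `(H'^X e) ∘ eX = H^X (e ∘ eQ)` in `mulVec` form. [cite: LinPryadko2024, App. proof of Thm 6(i)] -/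
theorem reindex_HX_mulVec_comp (C : CSSCode RX RZ Q) (eX : RX ≃ RX') (eZ : RZ ≃ RZ') (eQ : Q ≃ Q')
    (e : Q' → ZMod 2) : ((C.reindex eX eZ eQ).HX *ᵥ e) ∘ eX = C.HX *ᵥ (e ∘ eQ) :=
  reindex_zSyndrome_comp C eX eZ eQ e

omit [DecidableEq Q] [DecidableEq Q'] in
/-- Supports of pushed-forward vectors: `supp (f ∘ eQ⁻¹) = eQ(supp f)`. [cite: LinPryadko2024, App. proof of Thm 6(i)] -/
theorem supp_comp_symm (eQ : Q ≃ Q') (f : Q → ZMod 2) : supp (f ∘ eQ.symm) = (supp f).map eQ.toEmbedding := by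
  rw [supp_comp_equiv]
  rfl

/-- Non-erased supports correspond: `supp (f ∘ eQ⁻¹) ∖ eQ(Er) = eQ(supp f ∖ Er)`. [cite: LinPryadko2024, App. proof of Thm 6(i)] -/
theorem supp_comp_symm_sdiff (eQ : Q ≃ Q') (f : Q → ZMod 2) (Er : Finset Q) :
    supp (f ∘ eQ.symm) \ Er.map eQ.toEmbedding = (supp f \ Er).map eQ.toEmbedding := by
  rw [supp_comp_symm, Finset.map_sdiff]

omit [DecidableEq Q] [DecidableEq Q'] in
/-- **Conjugate erasure-aware decoders correct corresponding pairs**: the transported decoder corrects `(Er', e)` for the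
re-indexed code iff `D` corrects `(eQ⁻¹(Er'), e ∘ eQ)`. [cite: LinPryadko2024, §4.2 Thm 6 and App. proof of (i)] -/
theorem erasureCorrects_reindex_iff [Fintype RZ] [Fintype RZ'] (C : CSSCode RX RZ Q) (eX : RX ≃ RX') (eZ : RZ ≃ RZ')
    (eQ : Q ≃ Q') (D : ErasureDecoder Q (RX → ZMod 2)) (Er' : Finset Q') (e : Q' → ZMod 2) :
    (reindexErasureDecoder eX eQ D).Corrects (fun v => (C.reindex eX eZ eQ).HX *ᵥ v)
        ((C.reindex eX eZ eQ).rowSpZ : Set (Q' → ZMod 2)) Er' e ↔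
      D.Corrects (fun v => C.HX *ᵥ v) (C.rowSpZ : Set (Q → ZMod 2)) (Er'.map eQ.symm.toEmbedding) (e ∘ eQ) := by
  unfold ErasureDecoder.Corrects reindexErasureDecoder
  have hsyn : ((C.reindex eX eZ eQ).HX *ᵥ e) ∘ ⇑eX = C.HX *ᵥ (e ∘ eQ) := reindex_HX_mulVec_comp C eX eZ eQ e
  rw [hsyn]
  change (D (Er'.map eQ.symm.toEmbedding) (C.HX *ᵥ (e ∘ ⇑eQ)) ∘ ⇑eQ.symm + e ∈ (C.reindex eX eZ eQ).rowSpZ) ↔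
    (D (Er'.map eQ.symm.toEmbedding) (C.HX *ᵥ (e ∘ ⇑eQ)) + e ∘ ⇑eQ ∈ C.rowSpZ)
  rw [mem_rowSpZ_reindex_iff]
  have hcomp : (D (Er'.map eQ.symm.toEmbedding) (C.HX *ᵥ (e ∘ ⇑eQ)) ∘ ⇑eQ.symm + e) ∘ ⇑eQ =
      D (Er'.map eQ.symm.toEmbedding) (C.HX *ᵥ (e ∘ ⇑eQ)) + e ∘ ⇑eQ := by
    funext q; simp
  rw [hcomp]

/-- **Minimum weight outside the erasures is preserved by transport.** [cite: DumerKovalevPryadko2015, Thm 2 (the decoder); LinPryadko2024, §4.2 Thm 6] -/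
theorem isMinWeightOutside_reindexErasureDecoder (C : CSSCode RX RZ Q) (eX : RX ≃ RX') (eZ : RZ ≃ RZ')
    (eQ : Q ≃ Q') {D : ErasureDecoder Q (RX → ZMod 2)} (hD : D.IsMinWeightOutside C.HX) :
    (reindexErasureDecoder eX eQ D).IsMinWeightOutside (C.reindex eX eZ eQ).HX := by
  intro Er' e
  set e₀ : Q → ZMod 2 := e ∘ eQ with he₀
  set Er₀ : Finset Q := Er'.map eQ.symm.toEmbedding with hEr₀
  have hEr' : Er' = Er₀.map eQ.toEmbedding := (map_symm_map eQ Er').symm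
  have hsyn : ((C.reindex eX eZ eQ).HX *ᵥ e) ∘ ⇑eX = C.HX *ᵥ e₀ := reindex_HX_mulVec_comp C eX eZ eQ e
  obtain ⟨h1, h2⟩ := hD Er₀ e₀
  -- the transported decoder's output
  have hout : reindexErasureDecoder eX eQ D Er' ((C.reindex eX eZ eQ).HX *ᵥ e) =
      D Er₀ (C.HX *ᵥ e₀) ∘ eQ.symm := by
    simp only [reindexErasureDecoder, hsyn, hEr₀]
  rw [hout]
  refine ⟨?_, fun x' hx' => ?_⟩
  · -- syndromes agree after pulling back along `eX` (injective)
    have h := reindex_HX_mulVec_comp_symm C eX eZ eQ (D Er₀ (C.HX *ᵥ e₀))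
    have h' : ((C.reindex eX eZ eQ).HX *ᵥ (D Er₀ (C.HX *ᵥ e₀) ∘ ⇑eQ.symm)) ∘ ⇑eX =
        ((C.reindex eX eZ eQ).HX *ᵥ e) ∘ ⇑eX := h.trans (h1.trans hsyn.symm)
    funext r
    have := congrFun h' (eX.symm r)
    simpa using this
  · have hx₀ : C.HX *ᵥ (x' ∘ eQ) = C.HX *ᵥ e₀ := by
      rw [← reindex_HX_mulVec_comp C eX eZ eQ x', hx', hsyn]
    have h := h2 (x' ∘ eQ) hx₀
    rw [hEr', supp_comp_symm_sdiff, Finset.card_map]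
    have ex' : supp x' \ Er₀.map eQ.toEmbedding = (supp (x' ∘ eQ) \ Er₀).map eQ.toEmbedding := by
      have : x' = (x' ∘ ⇑eQ) ∘ ⇑eQ.symm := by funext q; simp
      conv_lhs => rw [this]
      exact supp_comp_symm_sdiff eQ _ _
    rw [ex', Finset.card_map]
    exact h

/-! ### The loss–error failure probability is a permutation invariant -/

open Classical in
/-- **`mixedFailureProb` is invariant under re-indexing**: for every erasure-aware decoder `D` of `C` and all rates `y, p`, the
transported decoder of `C.reindex eX eZ eQ` fails under (losses `y`, errors `p`) with exactly the probability with which `D`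
fails on `C` (reindex both sums along `Er ↦ eQ(Er)`, `E ↦ eQ(E)`; weights preserved, failure events correspond).
[cite: LinPryadko2024, §4.2 Thm 6 (permutation-equivalent codes)] [cite: DumerKovalevPryadko2015, Thm 2] [cite: DennisEtAl2002, §4.4 eq. (prob_E)] -/
theorem mixedFailureProb_reindex [Fintype RZ] [Fintype RZ'] (C : CSSCode RX RZ Q) (eX : RX ≃ RX') (eZ : RZ ≃ RZ')
    (eQ : Q ≃ Q') (D : ErasureDecoder Q (RX → ZMod 2)) (y p : ℝ) :
    mixedFailureProb (C.reindex eX eZ eQ).HX ((C.reindex eX eZ eQ).rowSpZ : Set (Q' → ZMod 2))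
        (reindexErasureDecoder eX eQ D) y p =
      mixedFailureProb C.HX (C.rowSpZ : Set (Q → ZMod 2)) D y p := by
  set φ : Finset Q ≃ Finset Q' := eQ.finsetCongr with hφ
  have hφ_apply : ∀ S : Finset Q, φ S = S.map eQ.toEmbedding := fun S => Equiv.finsetCongr_apply _ _
  have hφ_back : ∀ S : Finset Q, (φ S).map eQ.symm.toEmbedding = S := fun S => by
    rw [hφ_apply]; exact map_map_symm eQ S
  have hw : ∀ (q : ℝ) (S : Finset Q), bernoulliWeight q (φ S) = bernoulliWeight q S := by
    intro q S
    unfold bernoulliWeight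
    rw [hφ_apply, Finset.card_map, Fintype.card_congr eQ]
  -- the failure predicates correspond under `φ × φ`
  have hpred : ∀ Er E : Finset Q,
      (∃ e : Q' → ZMod 2, supp e \ φ Er = φ E \ φ Er ∧
        ¬ (reindexErasureDecoder eX eQ D).Corrects (fun v => (C.reindex eX eZ eQ).HX *ᵥ v)
          ((C.reindex eX eZ eQ).rowSpZ : Set (Q' → ZMod 2)) (φ Er) e) ↔
      (∃ x : Q → ZMod 2, supp x \ Er = E \ Er ∧
        ¬ D.Corrects (fun v => C.HX *ᵥ v) (C.rowSpZ : Set (Q → ZMod 2)) Er x) := by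
    intro Er E
    constructor
    · rintro ⟨e, heE, hfail⟩
      refine ⟨e ∘ eQ, ?_, ?_⟩
      · have h1 : supp e \ φ Er = (supp (e ∘ eQ) \ Er).map eQ.toEmbedding := by
          have : e = (e ∘ ⇑eQ) ∘ ⇑eQ.symm := by funext q; simp
          rw [hφ_apply]
          conv_lhs => rw [this]
          exact supp_comp_symm_sdiff eQ _ _
        rw [h1, hφ_apply, hφ_apply, ← Finset.map_sdiff, Finset.map_inj] at heE
        exact heE
      · rw [erasureCorrects_reindex_iff, hφ_back] at hfail
        exact hfail
    · rintro ⟨x, hxE, hfail⟩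
      refine ⟨x ∘ eQ.symm, ?_, ?_⟩
      · rw [hφ_apply, hφ_apply, supp_comp_symm_sdiff, ← Finset.map_sdiff, Finset.map_inj]
        exact hxE
      · rw [erasureCorrects_reindex_iff, hφ_back]
        have hx : (x ∘ ⇑eQ.symm) ∘ ⇑eQ = x := by funext q; simp
        rw [hx]
        exact hfail
  simp only [mixedFailureProb, Finset.sum_filter]
  rw [← φ.sum_comp]
  refine Fintype.sum_congr _ _ fun Er => ?_
  rw [hw]
  refine congrArg (HMul.hMul (bernoulliWeight y Er)) ?_
  rw [← φ.sum_comp]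
  refine Fintype.sum_congr _ _ fun E => ?_
  rw [hw]
  by_cases h : ∃ x : Q → ZMod 2, supp x \ Er = E \ Er ∧
      ¬ D.Corrects (fun v => C.HX *ᵥ v) (C.rowSpZ : Set (Q → ZMod 2)) Er x
  · rw [if_pos ((hpred Er E).2 h), if_pos h]
  · rw [if_neg (fun h' => h ((hpred Er E).1 h')), if_neg h]

omit [DecidableEq Q] [DecidableEq Q'] in
/-- **Re-indexing twice along inverse equivalences gives the code back.** [cite: LinPryadko2024, §4.2 Thm 6 (arXiv:2306.16400 chunk p0009 L66–74)] -/
theorem reindex_reindex_symm (C : CSSCode RX RZ Q) (eX : RX ≃ RX') (eZ : RZ ≃ RZ') (eQ : Q ≃ Q') :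
    (C.reindex eX eZ eQ).reindex eX.symm eZ.symm eQ.symm = C := by
  cases C with
  | mk HX HZ comm =>
    simp only [reindex]
    congr 1
    · rw [← Matrix.reindex_symm]; exact (Matrix.reindex eX eQ).symm_apply_apply HX
    · rw [← Matrix.reindex_symm]; exact (Matrix.reindex eZ eQ).symm_apply_apply HZ

/-- **Converse transport of the decoder class**: a minimum-weight-outside-the-erasures decoder `D'` of the re-indexed code
pulls back to one of `C`, of which `D'` is the transport. [cite: DumerKovalevPryadko2015, Thm 2 (the decoder); LinPryadko2024, §4.2 Thm 6] -/
theorem isMinWeightOutside_reindexErasureDecoder_symm (C : CSSCode RX RZ Q) (eX : RX ≃ RX') (eZ : RZ ≃ RZ')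
    (eQ : Q ≃ Q') {D' : ErasureDecoder Q' (RX' → ZMod 2)} (hD' : D'.IsMinWeightOutside (C.reindex eX eZ eQ).HX) :
    (reindexErasureDecoder eX.symm eQ.symm D').IsMinWeightOutside C.HX := by
  have h := isMinWeightOutside_reindexErasureDecoder (C.reindex eX eZ eQ) eX.symm eZ.symm eQ.symm hD'
  rwa [reindex_reindex_symm] at h

/-- **Failure probabilities of ANY decoder of the re-indexed code**: `mixedFailureProb (C.reindex …) D' = mixedFailureProb C D`
for the pulled-back decoder `D`. [cite: LinPryadko2024, §4.2 Thm 6] [cite: DumerKovalevPryadko2015, Thm 2] -/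
theorem mixedFailureProb_reindex_symm [Fintype RZ] [Fintype RZ'] (C : CSSCode RX RZ Q) (eX : RX ≃ RX')
    (eZ : RZ ≃ RZ') (eQ : Q ≃ Q') (D' : ErasureDecoder Q' (RX' → ZMod 2)) (y p : ℝ) :
    mixedFailureProb (C.reindex eX eZ eQ).HX ((C.reindex eX eZ eQ).rowSpZ : Set (Q' → ZMod 2)) D' y p =
      mixedFailureProb C.HX (C.rowSpZ : Set (Q → ZMod 2)) (reindexErasureDecoder eX.symm eQ.symm D') y p := by
  conv_lhs => rw [← reindexErasureDecoder_reindexErasureDecoder_symm eX eQ D']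
  exact mixedFailureProb_reindex C eX eZ eQ _ y p

end CSSCode

end Literature.InformationTheory.QuantumCodes
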